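import Mathlib
import Summits.MatrixMultiplication.MatrixMultiplication.Theorems.SnSubsetDichotomyPolynomialSlackHubFibring
import Summits.MatrixMultiplication.MatrixMultiplication.Theorems.SnSubsetDichotomyPolynomialSlackBlockCounts

/-!
# Pinned blocks: one-sided hub fibring with loss `n|I|²/ρ²`

Crux `Summit.MatrixMultiplication.MatrixMultiplication.Theses.SnSubsetDichotomy.PolynomialSlack`
(item `stmt-MatrixMultiplication-8306`), helper file of lead c9 (line `transport-split-hull`,
programme B: the excess/split case). For a TPP triple `(S, T, U)` of `S_n`, a `U`-position `k` and a
block `I ⊆ Fin n`, write `μ(v) = #{u ∈ U : u k = v}/|U|` (a probability vector on the values `v`: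
every `u` takes exactly one value at `k`) and `Y(v) = #{s ∈ S : s⁻¹ v ∈ I}/|S|` (so that
`Σ_v Y(v) = |I|`, by `card_filter_inv_apply_mem`). If the PINNED MASS `Σ_v μ(v)Y(v)` is at least
`ρ > 0`, then `|S||T||U| ≤ n|I|²B/ρ²` for every bound `B` on the volumes of TPP triples of `S_{n-1}`
(`volume_le_of_pinned_block_S`); `volume_le_of_pinned_block_T` is the same statement with `T, J, σ`
in place of `S, I, ρ`.

Proof. By Cauchy–Schwarz with the weights `μ`,
`ρ² ≤ (Σ_v μY)² ≤ (Σ_v μ)·(Σ_v μY·Y) ≤ M·Σ_v Y = M|I|`, where `M = max_v μ(v)Y(v) = μ(v₀)Y(v₀)`;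
and hub fibring (`hub_fibring`, with the trivial block `Fin n` on the idle side) gives
`|S||T||U|·M = #{s : s⁻¹ v₀ ∈ I}·|T|·#{u : u k = v₀} ≤ |I|·n·B`. Hence
`|S||T||U|·ρ² ≤ |S||T||U|·M·|I| ≤ n|I|²B`.
-/

namespace Summit.MatrixMultiplication.MatrixMultiplication.Theorems.PolynomialSlack

set_option linter.dupNamespace false

open scoped BigOperators
open Literature.Combinatorics.Additive (TripleProductProperty)

/-- Every `x ∈ X` takes exactly one value at the position `i`: `Σ_v #{x ∈ X : x i = v} = |X|`.
[folklore] -/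
private theorem pinnedBlock_sum_card_fibre {n : ℕ} (X : Finset (Equiv.Perm (Fin n))) (i : Fin n) :
    ∑ v : Fin n, (X.filter fun x => x i = v).card = X.card :=
  (Finset.card_eq_sum_card_fiberwise (f := fun x : Equiv.Perm (Fin n) => x i) (s := X)
    (t := Finset.univ) fun _ _ => Finset.mem_coe.2 (Finset.mem_univ _)).symm

/-- The block bumps of `X` at the values `v` have total size `|I|·|X|`:
`Σ_v #{x ∈ X : x⁻¹ v ∈ I} = |I|·|X|` (fibre over the position `i = x⁻¹ v ∈ I` by
`card_filter_inv_apply_mem`, swap the two sums, and count each fibre family once). [folklore] -/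
private theorem pinnedBlock_sum_card_bump {n : ℕ} (X : Finset (Equiv.Perm (Fin n)))
    (I : Finset (Fin n)) :
    ∑ v : Fin n, (X.filter fun x => x⁻¹ v ∈ I).card = I.card * X.card := by
  calc ∑ v : Fin n, (X.filter fun x => x⁻¹ v ∈ I).card
      = ∑ v : Fin n, ∑ i ∈ I, (X.filter fun x => x i = v).card :=
        Finset.sum_congr rfl fun v _ => card_filter_inv_apply_mem X I v
    _ = ∑ i ∈ I, ∑ v : Fin n, (X.filter fun x => x i = v).card := Finset.sum_comm
    _ = ∑ _i ∈ I, X.card := Finset.sum_congr rfl fun i _ => pinnedBlock_sum_card_fibre X i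
    _ = I.card * X.card := by rw [Finset.sum_const, smul_eq_mul]

/-- **The pinned-block inequality, abstract form.** For nonnegative weights `a` (of total `cU`) and
`b` (of total `L·cX`, `L ≥ 0`) on a finite type with `b(v)·cO·a(v) ≤ V` for every `v` (`cO ≥ 0`),
a lower bound `0 < ρ ≤ Σ_v (a(v)/cU)·(b(v)/cX)` (`cU, cX > 0`) forces `cX·cO·cU·ρ² ≤ L·V`:
Cauchy–Schwarz with the weights `a` gives `(Σ ab)² ≤ (Σ a)·(Σ ab·b) ≤ cU·M·L·cX` for the maximum
`M = a(v₀)b(v₀)` of `ab`, whence `ρ²·cU·cX ≤ L·M`, and `cO·M ≤ V`. [folklore] -/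
private theorem pinnedBlock_core {ι : Type*} [Fintype ι] (a b : ι → ℝ) (cX cU cO L V ρ : ℝ)
    (ha : ∀ v, 0 ≤ a v) (hb : ∀ v, 0 ≤ b v) (hcX : 0 < cX) (hcU : 0 < cU) (hcO : 0 ≤ cO)
    (hL : 0 ≤ L) (hsa : ∑ v, a v = cU) (hsb : ∑ v, b v = L * cX)
    (hfib : ∀ v, b v * cO * a v ≤ V) (hρ : 0 < ρ) (hmass : ρ ≤ ∑ v, a v / cU * (b v / cX)) :
    cX * cO * cU * ρ ^ 2 ≤ L * V := by
  -- the index type is nonempty, as the pinned mass is positive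
  have hne : (Finset.univ : Finset ι).Nonempty :=
    Finset.nonempty_of_sum_ne_zero (hρ.trans_le hmass).ne'
  -- a maximiser `v₀` of `a b`
  obtain ⟨v₀, -, hv₀⟩ := Finset.exists_max_image Finset.univ (fun v => a v * b v) hne
  have hM : ∀ v, a v * b v ≤ a v₀ * b v₀ := fun v => hv₀ v (Finset.mem_univ v)
  -- the pinned mass, unnormalised
  have hP : ρ * (cU * cX) ≤ ∑ v, a v * b v := by
    have h : ∑ v, a v / cU * (b v / cX) = (∑ v, a v * b v) / (cU * cX) := by
      rw [Finset.sum_div]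
      exact Finset.sum_congr rfl fun v _ => div_mul_div_comm _ _ _ _
    rw [h, le_div_iff₀ (mul_pos hcU hcX)] at hmass
    exact hmass
  -- Cauchy–Schwarz with the weights `a`
  have ht : ∀ v ∈ (Finset.univ : Finset ι), (a v * b v) ^ 2 ≤ a v * (a v * b v ^ 2) :=
    fun v _ => le_of_eq (by ring)
  have hCS : (∑ v, a v * b v) ^ 2 ≤ (∑ v, a v) * ∑ v, a v * b v ^ 2 :=
    Finset.sum_sq_le_sum_mul_sum_of_sq_le_mul Finset.univ (fun v _ => ha v)
      (fun v _ => mul_nonneg (ha v) (sq_nonneg _)) ht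
  -- `Σ a b² ≤ M Σ b = M L cX`
  have hbd : ∑ v, a v * b v ^ 2 ≤ a v₀ * b v₀ * (L * cX) := by
    rw [← hsb, Finset.mul_sum]
    refine Finset.sum_le_sum fun v _ => ?_
    calc a v * b v ^ 2 = a v * b v * b v := by ring
      _ ≤ a v₀ * b v₀ * b v := mul_le_mul_of_nonneg_right (hM v) (hb v)
  -- combine: `ρ² cU cX ≤ L M`
  have hA : ρ ^ 2 * (cU * cX) * (cU * cX) ≤ L * (a v₀ * b v₀) * (cU * cX) := by
    calc ρ ^ 2 * (cU * cX) * (cU * cX) = (ρ * (cU * cX)) ^ 2 := by ring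
      _ ≤ (∑ v, a v * b v) ^ 2 := pow_le_pow_left₀ (by positivity) hP 2
      _ ≤ (∑ v, a v) * ∑ v, a v * b v ^ 2 := hCS
      _ ≤ cU * (a v₀ * b v₀ * (L * cX)) := by
          rw [hsa]
          exact mul_le_mul_of_nonneg_left hbd hcU.le
      _ = L * (a v₀ * b v₀) * (cU * cX) := by ring
  have hA' : ρ ^ 2 * (cU * cX) ≤ L * (a v₀ * b v₀) :=
    le_of_mul_le_mul_right hA (mul_pos hcU hcX)
  -- fibring at `v₀`
  calc cX * cO * cU * ρ ^ 2 = cO * (ρ ^ 2 * (cU * cX)) := by ring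
    _ ≤ cO * (L * (a v₀ * b v₀)) := mul_le_mul_of_nonneg_left hA' hcO
    _ = L * (b v₀ * cO * a v₀) := by ring
    _ ≤ L * V := mul_le_mul_of_nonneg_left (hfib v₀) hL

/-- **Pinned block, `S`-side.** If `B` bounds the volume `|S'||T'||U'|` of every TPP triple of
`S_{n-1}`, then for every TPP triple `(S, T, U)` of `S_n` with `S, U` non-empty, every position `k`,
every block `I ⊆ Fin n` and every `ρ > 0` below the pinned mass
`Σ_v (#{u ∈ U : u k = v}/|U|)·(#{s ∈ S : s⁻¹ v ∈ I}/|S|)`: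
`|S||T||U| ≤ n·|I|²·B/ρ²`. With `μ(v) = #{u : u k = v}/|U|`, `Y(v) = #{s : s⁻¹ v ∈ I}/|S|` and
`M = max_v μY = μ(v₀)Y(v₀)`, Cauchy–Schwarz gives `ρ² ≤ (Σ μY)² ≤ Σ μY·Y ≤ M·Σ Y = M|I|`, and
`hub_fibring` (blocks `I` and `Fin n`) gives `|S||T||U|·M ≤ |I|·n·B`. [folklore] -/
theorem volume_le_of_pinned_block_S {n : ℕ} (B : ℕ)
    (hB : ∀ S' T' U' : Finset (Equiv.Perm (Fin (n - 1))), TripleProductProperty S' T' U' →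
      S'.card * T'.card * U'.card ≤ B)
    {S T U : Finset (Equiv.Perm (Fin n))} (hTPP : TripleProductProperty S T U)
    (hS0 : S.Nonempty) (hU0 : U.Nonempty) (k : Fin n) (I : Finset (Fin n)) (ρ : ℝ) (hρ : 0 < ρ)
    (hmass : ρ ≤ ∑ v : Fin n, ((U.filter fun u => u k = v).card : ℝ) / U.card *
      (((S.filter fun s => s⁻¹ v ∈ I).card : ℝ) / S.card)) :
    ((S.card * T.card * U.card : ℕ) : ℝ) ≤ n * (I.card : ℝ) ^ 2 * B / ρ ^ 2 := by
  -- the two totals: `Σ_v #{u : u k = v} = |U|` and `Σ_v #{s : s⁻¹ v ∈ I} = |I|·|S|`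
  have hsa : ∑ v : Fin n, ((U.filter fun u => u k = v).card : ℝ) = U.card := by
    exact_mod_cast pinnedBlock_sum_card_fibre U k
  have hsb : ∑ v : Fin n, ((S.filter fun s => s⁻¹ v ∈ I).card : ℝ) = I.card * S.card := by
    exact_mod_cast pinnedBlock_sum_card_bump S I
  -- hub fibring with the trivial block on the `T`-side
  have hfib : ∀ v : Fin n, ((S.filter fun s => s⁻¹ v ∈ I).card : ℝ) * T.card *
      ((U.filter fun u => u k = v).card : ℝ) ≤ I.card * n * B := by
    intro v
    have h := hub_fibring B hB hTPP I Finset.univ k v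
    have hT : (T.filter fun t => t⁻¹ v ∈ (Finset.univ : Finset (Fin n))) = T :=
      Finset.filter_true_of_mem fun t _ => Finset.mem_univ _
    rw [hT, Finset.card_univ, Fintype.card_fin] at h
    exact_mod_cast h
  have hcore := pinnedBlock_core (fun v => ((U.filter fun u => u k = v).card : ℝ))
    (fun v => ((S.filter fun s => s⁻¹ v ∈ I).card : ℝ)) S.card U.card T.card I.card
    ((I.card : ℝ) * n * B) ρ (fun _ => Nat.cast_nonneg _) (fun _ => Nat.cast_nonneg _)
    (Nat.cast_pos.2 hS0.card_pos) (Nat.cast_pos.2 hU0.card_pos) (Nat.cast_nonneg _)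
    (Nat.cast_nonneg _) hsa hsb hfib hρ hmass
  rw [le_div_iff₀ (pow_pos hρ 2)]
  calc ((S.card * T.card * U.card : ℕ) : ℝ) * ρ ^ 2 = (S.card : ℝ) * T.card * U.card * ρ ^ 2 := by
        push_cast; ring
    _ ≤ I.card * ((I.card : ℝ) * n * B) := hcore
    _ = n * (I.card : ℝ) ^ 2 * B := by ring

/-- **Pinned block, `T`-side.** If `B` bounds the volume `|S'||T'||U'|` of every TPP triple of
`S_{n-1}`, then for every TPP triple `(S, T, U)` of `S_n` with `T, U` non-empty, every position `k`,
every block `J ⊆ Fin n` and every `σ > 0` below the pinned mass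
`Σ_v (#{u ∈ U : u k = v}/|U|)·(#{t ∈ T : t⁻¹ v ∈ J}/|T|)`:
`|S||T||U| ≤ n·|J|²·B/σ²`. With `μ(v) = #{u : u k = v}/|U|`, `X(v) = #{t : t⁻¹ v ∈ J}/|T|` and
`M = max_v μX = μ(v₀)X(v₀)`, Cauchy–Schwarz gives `σ² ≤ (Σ μX)² ≤ Σ μX·X ≤ M·Σ X = M|J|`, and
`hub_fibring` (blocks `Fin n` and `J`) gives `|S||T||U|·M ≤ n·|J|·B`. [folklore] -/
theorem volume_le_of_pinned_block_T {n : ℕ} (B : ℕ)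
    (hB : ∀ S' T' U' : Finset (Equiv.Perm (Fin (n - 1))), TripleProductProperty S' T' U' →
      S'.card * T'.card * U'.card ≤ B)
    {S T U : Finset (Equiv.Perm (Fin n))} (hTPP : TripleProductProperty S T U)
    (hT0 : T.Nonempty) (hU0 : U.Nonempty) (k : Fin n) (J : Finset (Fin n)) (σ : ℝ) (hσ : 0 < σ)
    (hmass : σ ≤ ∑ v : Fin n, ((U.filter fun u => u k = v).card : ℝ) / U.card *
      (((T.filter fun t => t⁻¹ v ∈ J).card : ℝ) / T.card)) :
    ((S.card * T.card * U.card : ℕ) : ℝ) ≤ n * (J.card : ℝ) ^ 2 * B / σ ^ 2 := by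
  -- the two totals: `Σ_v #{u : u k = v} = |U|` and `Σ_v #{t : t⁻¹ v ∈ J} = |J|·|T|`
  have hsa : ∑ v : Fin n, ((U.filter fun u => u k = v).card : ℝ) = U.card := by
    exact_mod_cast pinnedBlock_sum_card_fibre U k
  have hsb : ∑ v : Fin n, ((T.filter fun t => t⁻¹ v ∈ J).card : ℝ) = J.card * T.card := by
    exact_mod_cast pinnedBlock_sum_card_bump T J
  -- hub fibring with the trivial block on the `S`-side
  have hfib : ∀ v : Fin n, ((T.filter fun t => t⁻¹ v ∈ J).card : ℝ) * S.card *
      ((U.filter fun u => u k = v).card : ℝ) ≤ n * J.card * B := by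
    intro v
    have h := hub_fibring B hB hTPP Finset.univ J k v
    have hS : (S.filter fun s => s⁻¹ v ∈ (Finset.univ : Finset (Fin n))) = S :=
      Finset.filter_true_of_mem fun s _ => Finset.mem_univ _
    rw [hS, Finset.card_univ, Fintype.card_fin] at h
    have h' : (S.card : ℝ) * ((T.filter fun t => t⁻¹ v ∈ J).card : ℝ) *
        ((U.filter fun u => u k = v).card : ℝ) ≤ n * J.card * B := by
      exact_mod_cast h
    calc ((T.filter fun t => t⁻¹ v ∈ J).card : ℝ) * S.card * ((U.filter fun u => u k = v).card : ℝ)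
        = (S.card : ℝ) * ((T.filter fun t => t⁻¹ v ∈ J).card : ℝ) *
            ((U.filter fun u => u k = v).card : ℝ) := by ring
      _ ≤ n * J.card * B := h'
  have hcore := pinnedBlock_core (fun v => ((U.filter fun u => u k = v).card : ℝ))
    (fun v => ((T.filter fun t => t⁻¹ v ∈ J).card : ℝ)) T.card U.card S.card J.card
    ((n : ℝ) * J.card * B) σ (fun _ => Nat.cast_nonneg _) (fun _ => Nat.cast_nonneg _)
    (Nat.cast_pos.2 hT0.card_pos) (Nat.cast_pos.2 hU0.card_pos) (Nat.cast_nonneg _)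
    (Nat.cast_nonneg _) hsa hsb hfib hσ hmass
  rw [le_div_iff₀ (pow_pos hσ 2)]
  calc ((S.card * T.card * U.card : ℕ) : ℝ) * σ ^ 2 = (T.card : ℝ) * S.card * U.card * σ ^ 2 := by
        push_cast; ring
    _ ≤ J.card * ((n : ℝ) * J.card * B) := hcore
    _ = n * (J.card : ℝ) ^ 2 * B := by ring

end Summit.MatrixMultiplication.MatrixMultiplication.Theorems.PolynomialSlack
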